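import Mathlib.Analysis.InnerProductSpace.l2Space
import Mathlib.Analysis.Distribution.SchwartzSpace.Deriv
import Literature.Analysis.OperatorTheory.CompactSelfAdjointEigenbasis
import Literature.MathematicalPhysics.QuantumLattice.LatticeScalarField
import Summits.QuantumFields.YangMills.Theorems.SqueezedSkewnessIsotypicProjections
import HarnessLib

/-!
# Joint diagonalisation of a compact positive contraction with a commuting unitary representation of `(ℤ/(2L+1))³`,
# and the Källén–Lehmann Parseval identity — content of STUB `stub_jointDiagonal` of crux `SqueezedSkewness.SpectralIdentificationL`
# (stmt-QuantumFields-22796; planner ym-idea-6 g8, LINE 2 «low-pass floor», pointers §2 steps 4–5), abbreviations unfolded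

§C: `P^m Π = (PΠ)^m Π` for commuting `P` and idempotent `Π`; eigen-coefficients `⟪b, T^m w⟫ = κ^m ⟪b, w⟫` of a self-adjoint `T`; Parseval
`Σ_i |⟪b_i, w⟫|² = ‖w‖²` along a Hilbert basis; the route statement's lattice phase is the bicharacter of `(ℤ/(2L+1))³`; admissible test
functions live on a finite box of lattice points.  §D: `jointDiagonal_hasSum` (any complex Hilbert space): with the isotypic projections
`Π_q` of `Theorems.SqueezedSkewnessIsotypicProjections`, each `T_q := P Π_q` is compact self-adjoint, so the tree's
`exists_hilbertBasis_eigenvectors_of_isSelfAdjoint` gives Hilbert bases `b^q` with `T_q b^q_i = κ^q_i b^q_i`, `κ ∈ [0,1]`;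
`⟪b^q_i, Π_q v_f⟫ = (Σ_x f(sx) (κ^q_i)^{x₀−1} χ_q(x⃗)) · ⟪b^q_i, Π_q ψ₀⟫`, Parseval per `q` and Pythagoras over `q` give the HasSum over
`Σ q, b^q`; the weights `W = |⟪b, Π_q ψ₀⟫|²` have countable support (summable), which is embedded in `ℕ` (zero padding) — so `W, μ, q`
are independent of `f`.  `jointDiagonal_l2` is the registered statement verbatim on `ℓ²(ℕ, ℂ)`.

Seat `ym-line-fcl-p3` g14 (cell ym-idea-1; free hands).  THEOREMS ONLY (no `def`, no `sorry`).  HONEST FRAMING: the companion stub `stub_osData`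
(L: the OS / transfer-operator datum with the thermal-limit covariance identity) is NOT proved here; no crux, NT statement, thermal limit or
mass gap is proved.  References: M. Reed, B. Simon, *Methods of Modern Mathematical Physics I* (1980), Thm. VI.16 [cite: ReedSimonI1980, Thm. VI.16];
I. Montvay, G. Münster, *Quantum Fields on a Lattice* (1994) §1.5.
-/

set_option autoImplicit false

noncomputable section

open scoped InnerProductSpace ComplexConjugate BigOperators
open Complex Finset

namespace Summit.QuantumFields.YangMills.Theorems.SqueezedSkewnessJointDiagonal

/-! ## §C Spectral bookkeeping: `P^m Π = (PΠ)^m Π`, eigen-coefficients, Parseval, lattice phases, finite support -/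

section Spectral

variable {E : Type*} [NormedAddCommGroup E] [InnerProductSpace ℂ E] [CompleteSpace E]

omit [CompleteSpace E] in
/-- If `P Π = Π P` and `Π² = Π` then `P^m Π = (P Π)^m Π` for every `m`. [folklore] -/
theorem pow_mul_proj_eq (P Pq : E →L[ℂ] E) (hcomm : P * Pq = Pq * P) (hidem : Pq * Pq = Pq) (m : ℕ) :
    P ^ m * Pq = (P * Pq) ^ m * Pq := by
  induction m with
  | zero => simp
  | succ m ih =>
    calc P ^ (m + 1) * Pq = P ^ m * (P * Pq) := by rw [pow_succ, mul_assoc]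
      _ = P ^ m * Pq * P := by rw [hcomm, mul_assoc]
      _ = (P * Pq) ^ m * Pq * P := by rw [ih]
      _ = (P * Pq) ^ m * (P * Pq) := by rw [mul_assoc, ← hcomm]
      _ = (P * Pq) ^ (m + 1) * Pq := by rw [pow_succ ((P * Pq)), mul_assoc ((P * Pq) ^ m) (P * Pq) Pq, mul_assoc P Pq Pq, hidem]

/-- Eigen-coefficients of a self-adjoint operator: `T b = κ b`, `κ ∈ ℝ` ⇒ `⟪b, T^m w⟫ = κ^m ⟪b, w⟫`. [folklore] -/
theorem inner_eigen_pow (T : E →L[ℂ] E) (hT : IsSelfAdjoint T) (b : E) (κ : ℝ) (hb : T b = (κ : ℂ) • b) (m : ℕ) (w : E) :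
    ⟪b, (T ^ m) w⟫_ℂ = (κ : ℂ) ^ m * ⟪b, w⟫_ℂ := by
  induction m generalizing w with
  | zero => simp [one_apply_eq_self]
  | succ m ih =>
    rw [pow_succ, mul_apply_eq_comp, ih (T w)]
    have hsym : ⟪T b, w⟫_ℂ = ⟪b, T w⟫_ℂ := ContinuousLinearMap.isSelfAdjoint_iff_isSymmetric.1 hT b w
    rw [← hsym, hb, inner_smul_left, Complex.conj_ofReal]
    ring

omit [CompleteSpace E] in
/-- Parseval along a Hilbert basis, in the form `Σ_i |⟪b_i, w⟫|² = ‖w‖²`. [cite: ReedSimonI1980, Thm. II.6] -/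
theorem hasSum_norm_sq_inner {ι : Type*} (b : HilbertBasis ι ℂ E) (w : E) :
    HasSum (fun i => ‖⟪b i, w⟫_ℂ‖ ^ 2) (‖w‖ ^ 2) := by
  have h := (b.hasSum_inner_mul_inner w w).mapL Complex.reCLM
  have hterm : ∀ i, Complex.reCLM (⟪w, b i⟫_ℂ * ⟪b i, w⟫_ℂ) = ‖⟪b i, w⟫_ℂ‖ ^ 2 := fun i => by
    rw [Complex.reCLM_apply, ← inner_conj_symm, RCLike.conj_mul]
    norm_cast
  have hlim : Complex.reCLM ⟪w, w⟫_ℂ = ‖w‖ ^ 2 := by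
    rw [Complex.reCLM_apply, inner_self_eq_norm_sq_to_K]
    norm_cast
  have h2 : (fun i => ‖⟪b i, w⟫_ℂ‖ ^ 2) = fun i => Complex.reCLM (⟪w, b i⟫_ℂ * ⟪b i, w⟫_ℂ) :=
    funext fun i => (hterm i).symm
  rw [h2, ← hlim]
  exact h

/-- The lattice phase of the route statement is the bicharacter of `(ℤ/(2L+1))³` on the spatial coordinates. [folklore] -/
theorem phase_eq_bichar (L : ℕ) {s : ℝ} (hs : 0 < s) (q : Fin 3 → ZMod (2 * L + 1)) (x : Fin 4 → ℤ) :
    Complex.exp (Complex.I * ((s * ∑ k : Fin 3, (2 * Real.pi * ((((q k).val : ℤ)) : ℝ) / (s * (2 * L + 1))) * (x k.succ : ℝ) : ℝ) : ℂ)) =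
      ∏ k, ZMod.stdAddChar (q k * (x k.succ : ZMod (2 * L + 1))) := by
  haveI : NeZero (2 * L + 1) := ⟨by omega⟩
  rw [bichar_intCast]
  congr 1
  have hs0 : s ≠ 0 := hs.ne'
  push_cast
  simp only [Finset.mul_sum, Finset.sum_div]
  refine Finset.sum_congr rfl fun k _ => ?_
  have hL : (2 * (L : ℂ) + 1) ≠ 0 := by
    have : (0 : ℝ) < 2 * L + 1 := by positivity
    exact_mod_cast this.ne'
  have hs0' : (s : ℂ) ≠ 0 := by exact_mod_cast hs0
  field_simp

/-- The lattice points carrying an admissible test function lie in a finite box: time coordinate in `[1, ⌈H/s⌉]`, spatial coordinates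
in `[−L, L]`. [folklore] -/
theorem coeff_eq_zero_of_not_mem_box (L : ℕ) {s : ℝ} (hs : 0 < s) (H : ℝ) (f : SchwartzMap (EuclideanSpace ℝ (Fin 4)) ℝ)
    (hf1 : tsupport (f : EuclideanSpace ℝ (Fin 4) → ℝ) ⊆ {y : EuclideanSpace ℝ (Fin 4) | 0 < y 0 ∧ y 0 ≤ H})
    (hf2 : tsupport (f : EuclideanSpace ℝ (Fin 4) → ℝ) ⊆ {y : EuclideanSpace ℝ (Fin 4) | ∀ i : Fin 3, |y i.succ| < s * (L + 1 / 2)})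
    (x : Fin 4 → ℤ)
    (hx : x ∉ Fintype.piFinset fun i : Fin 4 => if i = 0 then Finset.Icc (1 : ℤ) ⌈H / s⌉ else Finset.Icc (-(L : ℤ)) L) :
    f (s • Literature.MathematicalPhysics.QuantumLattice.siteToE (d := 4) x) = 0 := by
  by_contra hne
  apply hx
  have hmem : s • Literature.MathematicalPhysics.QuantumLattice.siteToE (d := 4) x ∈ tsupport (f : EuclideanSpace ℝ (Fin 4) → ℝ) :=
    subset_tsupport _ (Function.mem_support.2 hne)
  have h1 := hf1 hmem
  have h2 := hf2 hmem
  simp only [Set.mem_setOf_eq, PiLp.smul_apply, Literature.MathematicalPhysics.QuantumLattice.siteToE_apply, smul_eq_mul] at h1 h2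
  rw [Fintype.mem_piFinset]
  intro i
  by_cases hi : i = 0
  · subst hi
    rw [if_pos rfl, Finset.mem_Icc]
    obtain ⟨h1a, h1b⟩ := h1
    have hpos : (0 : ℝ) < x 0 := (mul_pos_iff_of_pos_left hs).1 h1a
    have hxle : (x 0 : ℝ) ≤ H / s := by
      rw [le_div_iff₀ hs, mul_comm]; exact h1b
    constructor
    · have : (0 : ℤ) < x 0 := by exact_mod_cast hpos
      omega
    · exact Int.cast_le.1 (hxle.trans (Int.le_ceil _))
  · obtain ⟨j, rfl⟩ := Fin.eq_succ_of_ne_zero hi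
    rw [if_neg hi, Finset.mem_Icc]
    have hj := h2 j
    rw [abs_mul, abs_of_pos hs] at hj
    have hlt : (|x j.succ| : ℝ) < L + 1 / 2 := by
      have := lt_of_mul_lt_mul_left hj hs.le
      exact_mod_cast this
    have hlt' : |x j.succ| < (L : ℤ) + 1 := by
      have h' : ((|x j.succ| : ℤ) : ℝ) < (L : ℝ) + 1 := by push_cast; linarith
      exact_mod_cast h'
    have hle : |x j.succ| ≤ (L : ℤ) := Int.lt_add_one_iff.1 hlt'
    exact abs_le.1 hle

end Spectral

/-! ## §D The registered statement: joint diagonalisation + Parseval, weights re-indexed by `ℕ` -/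

section Main

variable {E : Type*} [NormedAddCommGroup E] [InnerProductSpace ℂ E] [CompleteSpace E]

open Literature.MathematicalPhysics.QuantumLattice (siteToE)

/-- **Joint diagonalisation and the Källén–Lehmann Parseval identity** (generic Hilbert space).  For a compact self-adjoint positive
contraction `P` commuting with a norm-preserving representation `U` of `ℤ³` factoring through `(ℤ/(2L+1))³`, there are weights `W_n ≥ 0`,
levels `μ_n ∈ [0,1]` and momenta `q_n ∈ ℤ³` (all independent of the test function) such that for every real Schwartz `f` supported in
`{0 < y₀ ≤ H} ∩ {|y_i| < s(L+½)}`: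
`Σ_n W_n |Σ_x f(sx) μ_n^{x₀−1} e^{2πi q_n·x⃗/(2L+1)}|² = ‖Σ_x f(sx) P^{x₀−1} U(x⃗) ψ₀‖²`.
Proof: isotypic projections `Π_q` (§A) for the characters of `(ℤ/(2L+1))³` (§B); `P Π_q` compact self-adjoint ⇒ Hilbert basis of
eigenvectors (tree `exists_hilbertBasis_eigenvectors_of_isSelfAdjoint`); `⟪b_i, Π_q v_f⟫ = (Σ_x f(sx) κ_i^{x₀−1} χ_q(x⃗))·⟪b_i, Π_q ψ₀⟫`;
Parseval per `q`, Pythagoras over `q`; the countable support of the weights is embedded in `ℕ`. [cite: ReedSimonI1980, Thm. VI.16] -/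
theorem jointDiagonal_hasSum (L : ℕ) (s : ℝ) (hs : 0 < s) (P : E →L[ℂ] E) (U : (Fin 3 → ℤ) → (E →L[ℂ] E)) (ψ₀ : E)
    (hPsa : IsSelfAdjoint P) (hPc : IsCompactOperator P) (hPn : ‖P‖ ≤ 1) (hPpos : ∀ v : E, 0 ≤ RCLike.re (inner ℂ (P v) v))
    (hU0 : U 0 = 1) (hUadd : ∀ x y : Fin 3 → ℤ, U (x + y) = U x * U y)
    (hUper : ∀ x y : Fin 3 → ℤ, (∀ i, ((x i : ℤ) : ZMod (2 * L + 1)) = ((y i : ℤ) : ZMod (2 * L + 1))) → U x = U y)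
    (hUnorm : ∀ (x : Fin 3 → ℤ) (v : E), ‖U x v‖ = ‖v‖) (hPU : ∀ x : Fin 3 → ℤ, P * U x = U x * P) :
    ∃ (W μ : ℕ → ℝ) (q : ℕ → Fin 3 → ℤ), (∀ n, 0 ≤ W n) ∧ (∀ n, 0 ≤ μ n ∧ μ n ≤ 1) ∧
      ∀ (H : ℝ) (f : SchwartzMap (EuclideanSpace ℝ (Fin 4)) ℝ),
        tsupport (f : EuclideanSpace ℝ (Fin 4) → ℝ) ⊆ {y : EuclideanSpace ℝ (Fin 4) | 0 < y 0 ∧ y 0 ≤ H} →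
        tsupport (f : EuclideanSpace ℝ (Fin 4) → ℝ) ⊆ {y : EuclideanSpace ℝ (Fin 4) | ∀ i : Fin 3, |y i.succ| < s * (L + 1 / 2)} →
        HasSum (fun n : ℕ => W n * ‖(∑' x : Fin 4 → ℤ, (((f (s • siteToE (d := 4) x) * μ n ^ (Int.toNat (x 0 - 1))) : ℝ) : ℂ) *
            Complex.exp (Complex.I * ((s * ∑ k : Fin 3, (2 * Real.pi * (q n k : ℝ) / (s * (2 * L + 1))) * (x k.succ : ℝ) : ℝ) : ℂ)))‖ ^ 2)
          (‖(∑' x : Fin 4 → ℤ, ((f (s • siteToE (d := 4) x) : ℝ) : ℂ) •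
            ((P ^ (Int.toNat (x 0 - 1))) ((U (fun i : Fin 3 => x i.succ)) ψ₀)))‖ ^ 2) := by
  classical
  haveI hN0 : NeZero (2 * L + 1) := ⟨by omega⟩
  -- §1 the finite representation `V` of `Γ = (ℤ/(2L+1))³`
  let V : (Fin 3 → ZMod (2 * L + 1)) → E →L[ℂ] E := fun γ => U (fun i => ((γ i).val : ℤ))
  have hUV : ∀ y : Fin 3 → ℤ, U y = V (fun i => (y i : ZMod (2 * L + 1))) := fun y =>
    hUper _ _ (fun i => by simp)
  have hV0 : V 0 = 1 := by
    have : (fun i : Fin 3 => (((0 : Fin 3 → ZMod (2 * L + 1)) i).val : ℤ)) = 0 := by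
      funext i; simp [ZMod.val_zero]
    show U _ = 1
    rw [this, hU0]
  have hVadd : ∀ γ γ', V (γ + γ') = V γ * V γ' := fun γ γ' => by
    show U _ = U _ * U _
    rw [← hUadd]
    refine hUper _ _ (fun i => ?_)
    push_cast
    simp
  have hVnorm : ∀ γ v, ‖V γ v‖ = ‖v‖ := fun γ v => hUnorm _ v
  have hPV : ∀ γ, P * V γ = V γ * P := fun γ => hPU _
  -- §2 the characters and the isotypic projections
  let χ : (Fin 3 → ZMod (2 * L + 1)) → (Fin 3 → ZMod (2 * L + 1)) → ℂ := fun q γ => ∏ k, ZMod.stdAddChar (q k * γ k)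
  have hχadd : ∀ q γ γ', χ q (γ + γ') = χ q γ * χ q γ' := fun q γ γ' => bichar_add q γ γ'
  have hχzero : ∀ q, χ q 0 = 1 := fun q => bichar_zero q
  have hχconj : ∀ q γ, conj (χ q γ) = χ q (-γ) := fun q γ => bichar_conj q γ
  have hχorth : ∀ q q', ∑ γ, χ q γ * conj (χ q' γ) = if q = q' then (Fintype.card (Fin 3 → ZMod (2 * L + 1)) : ℂ) else 0 :=
    fun q q' => bichar_orth q q'
  have hχdual : ∀ γ, ∑ q, conj (χ q γ) = if γ = 0 then (Fintype.card (Fin 3 → ZMod (2 * L + 1)) : ℂ) else 0 :=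
    fun γ => bichar_dual γ
  let Pr : (Fin 3 → ZMod (2 * L + 1)) → E →L[ℂ] E := fun q =>
    ((Fintype.card (Fin 3 → ZMod (2 * L + 1)) : ℂ)⁻¹) • ∑ γ, conj (χ q γ) • V γ
  have hPr : ∀ q, Pr q = ((Fintype.card (Fin 3 → ZMod (2 * L + 1)) : ℂ)⁻¹) • ∑ γ, conj (χ q γ) • V γ := fun q => rfl
  have hidem : ∀ q, Pr q * Pr q = Pr q := fun q => by
    have h := proj_mul_proj χ V Pr hχadd hχconj hχorth hVadd hPr q q
    rwa [if_pos rfl] at h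
  have hcommP : ∀ q, P * Pr q = Pr q * P := comm_proj χ V Pr P hPV hPr
  have hsaPr : ∀ q, IsSelfAdjoint (Pr q) := isSelfAdjoint_proj χ V Pr hχconj hV0 hVadd hVnorm hPr
  have hPrV : ∀ q γ, Pr q * V γ = χ q γ • Pr q := proj_mul_rep χ V Pr hχadd hχconj hVadd hPr
  have hinnerPr : ∀ q (u v : E), ⟪Pr q u, v⟫_ℂ = ⟪u, Pr q v⟫_ℂ := inner_proj_left χ V Pr hχconj hV0 hVadd hVnorm hPr
  have hnormPr : ∀ q v, ‖Pr q v‖ ≤ ‖v‖ := norm_proj_le χ V Pr hχadd hχzero hχconj hVnorm hPr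
  -- §3 `T_q = P Π_q` and its eigenbases
  have hTsa : ∀ q, IsSelfAdjoint (P * Pr q) := fun q => (IsSelfAdjoint.commute_iff hPsa (hsaPr q)).1 (hcommP q)
  have hTc : ∀ q, IsCompactOperator (P * Pr q) := fun q => hPc.comp_clm (Pr q)
  choose sI b κ hb hTb using fun q =>
    Literature.Analysis.OperatorTheory.exists_hilbertBasis_eigenvectors_of_isSelfAdjoint (hTc q) (hTsa q)
  -- §4 the f-independent data on the index set `I = Σ q, sI q`
  let Wf : (Σ q, sI q) → ℝ := fun ι => ‖⟪b ι.1 ι.2, Pr ι.1 ψ₀⟫_ℂ‖ ^ 2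
  let μf : (Σ q, sI q) → ℝ := fun ι => κ ι.1 ι.2
  let qf : (Σ q, sI q) → (Fin 3 → ℤ) := fun ι k => ((ι.1 k).val : ℤ)
  have hWf0 : ∀ ι, 0 ≤ Wf ι := fun ι => by positivity
  have hμf : ∀ ι, 0 ≤ μf ι ∧ μf ι ≤ 1 := by
    rintro ⟨q, i⟩
    have hnb : ‖b q i‖ = 1 := (b q).orthonormal.1 i
    have heig := hTb q i
    -- κ = ⟪b, T b⟫
    have hκ : ((κ q i : ℝ) : ℂ) = ⟪b q i, (P * Pr q) (b q i)⟫_ℂ := by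
      rw [heig, inner_smul_right, inner_self_eq_norm_sq_to_K, hnb]; simp
    have hw : ⟪b q i, (P * Pr q) (b q i)⟫_ℂ = ⟪Pr q (b q i), P (Pr q (b q i))⟫_ℂ := by
      conv_lhs => rw [← hidem q]
      rw [mul_apply_eq_comp, mul_apply_eq_comp, ← mul_apply_eq_comp P (Pr q), hcommP q, mul_apply_eq_comp, hinnerPr]
    constructor
    · have h1 : 0 ≤ RCLike.re ⟪P (Pr q (b q i)), Pr q (b q i)⟫_ℂ := hPpos _
      rw [← inner_conj_symm, RCLike.conj_re] at h1
      have : (κ q i : ℝ) = RCLike.re ⟪Pr q (b q i), P (Pr q (b q i))⟫_ℂ := by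
        rw [← hw, ← hκ]; simp
      show 0 ≤ κ q i
      rw [this]; exact h1
    · have hle : ‖⟪b q i, (P * Pr q) (b q i)⟫_ℂ‖ ≤ 1 := by
        refine (norm_inner_le_norm _ _).trans ?_
        rw [hnb, one_mul, mul_apply_eq_comp]
        refine (P.le_opNorm _).trans ?_
        calc ‖P‖ * ‖Pr q (b q i)‖ ≤ 1 * ‖b q i‖ := mul_le_mul hPn (hnormPr q _) (norm_nonneg _) zero_le_one
          _ = 1 := by rw [hnb, one_mul]
      show κ q i ≤ 1
      have : |κ q i| ≤ 1 := by
        have h2 : ‖((κ q i : ℝ) : ℂ)‖ ≤ 1 := by rw [hκ]; exact hle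
        rwa [Complex.norm_real, Real.norm_eq_abs] at h2
      exact (abs_le.1 this).2
  -- §5 countable support of the weights, re-indexing by `ℕ`
  have hWsum : ∀ q, HasSum (fun i : sI q => ‖⟪b q i, Pr q ψ₀⟫_ℂ‖ ^ 2) (‖Pr q ψ₀‖ ^ 2) := fun q =>
    hasSum_norm_sq_inner (b q) _
  have hWfsum : Summable Wf := by
    refine (summable_sigma_of_nonneg hWf0).2 ⟨fun q => (hWsum q).summable, ?_⟩
    exact (hasSum_fintype _).summable
  have hJ : (Function.support Wf).Countable := hWfsum.countable_support
  obtain ⟨e, he⟩ := Set.countable_iff_exists_injective.1 hJ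
  refine ⟨Function.extend e (fun j => Wf j.1) 0, Function.extend e (fun j => μf j.1) 0, Function.extend e (fun j => qf j.1) 0,
    ?_, ?_, ?_⟩
  · intro n
    by_cases hn : ∃ j, e j = n
    · obtain ⟨j, rfl⟩ := hn
      rw [he.extend_apply]; exact hWf0 _
    · rw [Function.extend_apply' _ _ _ hn]; simp
  · intro n
    by_cases hn : ∃ j, e j = n
    · obtain ⟨j, rfl⟩ := hn
      rw [he.extend_apply]; exact hμf _
    · rw [Function.extend_apply' _ _ _ hn]; simp
  -- §6 the identity for an admissible test function
  intro H f hf1 hf2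
  -- abbreviations
  set c : (Fin 4 → ℤ) → ℂ := fun x => ((f (s • siteToE (d := 4) x) : ℝ) : ℂ) with hc
  set m : (Fin 4 → ℤ) → ℕ := fun x => Int.toNat (x 0 - 1) with hm
  set B : Finset (Fin 4 → ℤ) :=
    Fintype.piFinset fun i : Fin 4 => if i = 0 then Finset.Icc (1 : ℤ) ⌈H / s⌉ else Finset.Icc (-(L : ℤ)) L with hB
  have hc0 : ∀ x ∉ B, c x = 0 := fun x hx => by
    simp only [hc, coeff_eq_zero_of_not_mem_box L hs H f hf1 hf2 x hx, Complex.ofReal_zero]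
  -- the amplitude of index `ι` as a finite sum against the bicharacter
  let A : (Σ q, sI q) → ℝ := fun ι =>
    ‖(∑' x : Fin 4 → ℤ, (((f (s • siteToE (d := 4) x) * μf ι ^ (Int.toNat (x 0 - 1))) : ℝ) : ℂ) *
      Complex.exp (Complex.I * ((s * ∑ k : Fin 3, (2 * Real.pi * (qf ι k : ℝ) / (s * (2 * L + 1))) * (x k.succ : ℝ) : ℝ) : ℂ)))‖ ^ 2
  have hA : ∀ ι : Σ q, sI q, A ι = ‖∑ x ∈ B, c x * (((κ ι.1 ι.2 : ℝ) : ℂ) ^ m x * χ ι.1 (fun k => (x k.succ : ZMod (2 * L + 1))))‖ ^ 2 := by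
    rintro ⟨q, i⟩
    simp only [A]
    congr 2
    rw [tsum_eq_sum (s := B)]
    · refine Finset.sum_congr rfl fun x _ => ?_
      rw [phase_eq_bichar L hs q x]
      push_cast
      simp only [hc, hm, χ]
      ring
    · intro x hx
      have : f (s • siteToE (d := 4) x) = 0 := coeff_eq_zero_of_not_mem_box L hs H f hf1 hf2 x hx
      rw [this]; simp
  -- the vector `v_f` as a finite sum
  set v : E := ∑' x : Fin 4 → ℤ, c x • ((P ^ m x) ((U (fun i : Fin 3 => x i.succ)) ψ₀)) with hv
  have hvB : v = ∑ x ∈ B, c x • ((P ^ m x) ((U (fun i : Fin 3 => x i.succ)) ψ₀)) := by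
    rw [hv, tsum_eq_sum (s := B)]
    intro x hx; rw [hc0 x hx, zero_smul]
  -- the coefficient identity
  have hcoef : ∀ (q : Fin 3 → ZMod (2 * L + 1)) (i : sI q),
      ⟪b q i, Pr q v⟫_ℂ = (∑ x ∈ B, c x * (((κ q i : ℝ) : ℂ) ^ m x * χ q (fun k => (x k.succ : ZMod (2 * L + 1))))) *
        ⟪b q i, Pr q ψ₀⟫_ℂ := by
    intro q i
    rw [hvB, map_sum, inner_sum, Finset.sum_mul]
    refine Finset.sum_congr rfl fun x _ => ?_
    have hop : Pr q ((P ^ m x) ((U (fun i : Fin 3 => x i.succ)) ψ₀)) =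
        χ q (fun k => (x k.succ : ZMod (2 * L + 1))) • ((P * Pr q) ^ m x) (Pr q ψ₀) := by
      rw [hUV, ← mul_apply_eq_comp, ← mul_apply_eq_comp]
      have hcomm_pow : Pr q * P ^ m x = P ^ m x * Pr q := ((show Commute (Pr q) P from (hcommP q).symm).pow_right (m x)).eq
      rw [hcomm_pow, mul_assoc, hPrV, mul_smul_comm, pow_mul_proj_eq P (Pr q) (hcommP q) (hidem q) (m x), smul_apply,
        mul_apply_eq_comp]
    rw [map_smul, hop, inner_smul_right, inner_smul_right,
      inner_eigen_pow (P * Pr q) (hTsa q) (b q i) (κ q i) (hTb q i) (m x) (Pr q ψ₀)]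
    ring
  -- Parseval per `q`
  have hPars : ∀ q, HasSum (fun i : sI q => Wf ⟨q, i⟩ * A ⟨q, i⟩) (‖Pr q v‖ ^ 2) := by
    intro q
    have h := hasSum_norm_sq_inner (b q) (Pr q v)
    have heq : (fun i : sI q => Wf ⟨q, i⟩ * A ⟨q, i⟩) = fun i => ‖⟪b q i, Pr q v⟫_ℂ‖ ^ 2 := by
      funext i
      rw [hcoef q i, hA ⟨q, i⟩, norm_mul, mul_pow]
      simp only [Wf]
      ring
    rw [heq]; exact h
  -- Pythagoras over `q`
  have hPyth : ‖v‖ ^ 2 = ∑ q, ‖Pr q v‖ ^ 2 := norm_sq_eq_sum_norm_sq_proj χ V Pr hχadd hχconj hχorth hχdual hV0 hVadd hVnorm hPr v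
  -- the sum over the Σ-type
  have key : HasSum (fun ι : Σ q, sI q => Wf ι * A ι) (‖v‖ ^ 2) := by
    rw [hPyth]
    refine HasSum.sigma_of_hasSum (hasSum_fintype _) hPars ?_
    refine (summable_sigma_of_nonneg fun ι => mul_nonneg (hWf0 ι) (by positivity)).2 ⟨fun q => (hPars q).summable, ?_⟩
    exact (hasSum_fintype _).summable
  -- restrict to the support of the weights and transfer to `ℕ`
  have hsupp : Function.support (fun ι : Σ q, sI q => Wf ι * A ι) ⊆ Function.support Wf := by
    intro ι hι
    simp only [Function.mem_support, ne_eq] at hι ⊢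
    intro h0; exact hι (by rw [h0, zero_mul])
  have h1 : HasSum ((fun ι : Σ q, sI q => Wf ι * A ι) ∘ ((↑) : Function.support Wf → Σ q, sI q)) (‖v‖ ^ 2) :=
    (hasSum_subtype_iff_of_support_subset hsupp).2 key
  have h2 := (hasSum_extend_zero he).2 h1
  convert h2 using 1
  funext n
  by_cases hn : ∃ j, e j = n
  · obtain ⟨j, rfl⟩ := hn
    rw [he.extend_apply, he.extend_apply, he.extend_apply, he.extend_apply]
    rfl
  · simp only [Function.extend_apply' _ _ _ hn, Pi.zero_apply, zero_mul]

/-- **The registered statement `stub_jointDiagonal` of crux `SpectralIdentificationL` (stmt-QuantumFields-22796), abbreviations unfolded,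
on `ℓ²(ℕ, ℂ)`** — the specialisation of `jointDiagonal_hasSum`. [cite: ReedSimonI1980, Thm. VI.16] -/
theorem jointDiagonal_l2 :
    ∀ (L : ℕ) (s : ℝ), 1 ≤ L → 0 < s → ∀ (P : lp (fun _ : ℕ => ℂ) 2 →L[ℂ] lp (fun _ : ℕ => ℂ) 2)
      (U : (Fin 3 → ℤ) → (lp (fun _ : ℕ => ℂ) 2 →L[ℂ] lp (fun _ : ℕ => ℂ) 2)) (ψ₀ : lp (fun _ : ℕ => ℂ) 2),
      IsSelfAdjoint P ∧ IsCompactOperator P ∧ ‖P‖ ≤ 1 ∧ (∀ v : lp (fun _ : ℕ => ℂ) 2, 0 ≤ RCLike.re (inner ℂ (P v) v)) ∧ U 0 = 1 ∧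
        (∀ x y : Fin 3 → ℤ, U (x + y) = U x * U y) ∧
        (∀ x y : Fin 3 → ℤ, (∀ i, ((x i : ℤ) : ZMod (2 * L + 1)) = ((y i : ℤ) : ZMod (2 * L + 1))) → U x = U y) ∧
        (∀ (x : Fin 3 → ℤ) (v : lp (fun _ : ℕ => ℂ) 2), ‖U x v‖ = ‖v‖) ∧ (∀ x : Fin 3 → ℤ, P * U x = U x * P) →
      ∃ (W μ : ℕ → ℝ) (q : ℕ → Fin 3 → ℤ), (∀ n, 0 ≤ W n) ∧ (∀ n, 0 ≤ μ n ∧ μ n ≤ 1) ∧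
        ∀ (H : ℝ) (f : SchwartzMap (EuclideanSpace ℝ (Fin 4)) ℝ),
          tsupport (f : EuclideanSpace ℝ (Fin 4) → ℝ) ⊆ {y : EuclideanSpace ℝ (Fin 4) | 0 < y 0 ∧ y 0 ≤ H} →
          tsupport (f : EuclideanSpace ℝ (Fin 4) → ℝ) ⊆ {y : EuclideanSpace ℝ (Fin 4) | ∀ i : Fin 3, |y i.succ| < s * (L + 1 / 2)} →
          HasSum (fun n : ℕ => W n * ‖(∑' x : Fin 4 → ℤ, (((f (s • Literature.MathematicalPhysics.QuantumLattice.siteToE (d := 4) x) *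
              μ n ^ (Int.toNat (x 0 - 1))) : ℝ) : ℂ) * Complex.exp (Complex.I * ((s * ∑ k : Fin 3, (2 * Real.pi * (q n k : ℝ) /
              (s * (2 * L + 1))) * (x k.succ : ℝ) : ℝ) : ℂ)))‖ ^ 2)
            (‖(∑' x : Fin 4 → ℤ, ((f (s • Literature.MathematicalPhysics.QuantumLattice.siteToE (d := 4) x) : ℝ) : ℂ) •
              ((P ^ (Int.toNat (x 0 - 1))) ((U (fun i : Fin 3 => x i.succ)) ψ₀)))‖ ^ 2) := by
  intro L s _hL hs P U ψ₀ h
  obtain ⟨hPsa, hPc, hPn, hPpos, hU0, hUadd, hUper, hUnorm, hPU⟩ := h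
  exact jointDiagonal_hasSum L s hs P U ψ₀ hPsa hPc hPn hPpos hU0 hUadd hUper hUnorm hPU

end Main

end Summit.QuantumFields.YangMills.Theorems.SqueezedSkewnessJointDiagonal

end
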